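import Summits.FinalStateConjecture.FinalStateConjecture.Theorems.BartnikGapSettlingBondiBartnikRigidityMarchingLemmaChartCausal
import Literature.Geometry.Lorentzian.CauchyDevelopmentRestrict
import HarnessLib

/-!
# K2b-5 `stub_marchingLemma`, brick 17: the orientation character of an exact chart is locally
# constant — line `direct-method-on-the-cone` (crux `BondiBartnikRigidity`, stmt-FinalStateConjecture-10807)

For an exact chart `Ψ` of the collar background on `pullK Q` (`Q` an open Kerr-side set; `Φ = Ψ ∘ lab`)
the scalar `q ↦ g_𝒮(T_{Φ q}, dΦ_q V_q)` (orienting field `T` of `𝒮`, Kerr-star orientation `V`) is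
continuous and never `0` on `Q` (`continuous_orientSign`, `orientSign_ne_zero`), so it has constant sign
on connected subsets of `Q` (`orientSign_neg_of_isPreconnected`): an exact chart which pushes `V` to a
future-directed vector at ONE point of a connected open Kerr-side set does so at all of its points.  This
is how the orientation clause of the marching invariant is obtained for the boundary collar chart near
the inner slab (report K2b-a2 §3 (ii)): the chart is forced to be orientation preserving at points with
`r > 2M` by a vertical-segment argument, and `{0 < t* < η} × {M < r < 3M}` is connected.

References: O'Neill 1983, Ch. 5, Lemma 5.32 and p. 145 [ONeill1983].  No definitions, no named facts.
-/

noncomputable section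

-- D-0017: single-problem summit, `Summit.<S>.<S>.…` by design (cf. lakefile `weak.linter.dupNamespace`).
set_option linter.dupNamespace false
set_option maxSynthPendingDepth 3

open Set Filter Function Topology TopologicalSpace Bundle
open Literature.Geometry.Lorentzian
open scoped Manifold ContDiff Topology ENNReal

namespace Summit.FinalStateConjecture.FinalStateConjecture.Theorems.BondiBartnikRigidity.DirectMethod

namespace OrientK

/-! ### Continuity of scalar products of continuous fields along a map -/

section Generic

variable {E : Type*} [NormedAddCommGroup E] [NormedSpace ℝ E] {H : Type*} [TopologicalSpace H]
  {I : ModelWithCorners ℝ E H} {n : ℕ∞ω} {M : Type*} [TopologicalSpace M] [ChartedSpace H M]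
  [IsManifold I ∞ M]
  {E' : Type*} [NormedAddCommGroup E'] [NormedSpace ℝ E'] {H' : Type*} [TopologicalSpace H']
  {N : Type*} [TopologicalSpace N] [ChartedSpace H' N]

-- adapted from `Literature/Geometry/Lorentzian/CausalityProofs.lean` (`continuous_val_of_continuous`,
-- domain `ℝ` replaced by a manifold `N`)
/-- If `V`, `W` are fields along a continuous map `c : N → M` which are continuous as maps into the
tangent bundle, then `y ↦ g_{c(y)}(V y, W y)` is continuous (the metric is a continuous section of the
bundle of bilinear forms). [cite: ONeill1983, Ch. 3, Def. 3.1] -/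
theorem continuous_val_of_continuous (I' : ModelWithCorners ℝ E' H') [IsManifold I' ∞ N]
    (g : LorentzianMetric I n M) {c : N → M} (hc : Continuous c)
    {V W : ∀ y, TangentSpace I (c y)}
    (hV : Continuous (fun y ↦ (⟨c y, V y⟩ : TangentBundle I M)))
    (hW : Continuous (fun y ↦ (⟨c y, W y⟩ : TangentBundle I M))) :
    Continuous (fun y ↦ g.val (c y) (V y) (W y)) := by
  have hg0 : ContMDiff I (I.prod 𝓘(ℝ, E →L[ℝ] E →L[ℝ] ℝ)) 0
      (fun b ↦ TotalSpace.mk' (E →L[ℝ] E →L[ℝ] ℝ) b (g.val b)) := g.contMDiff.of_le bot_le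
  have hc0 : ContMDiff I' I 0 c := contMDiff_zero_iff.mpr hc
  have hV0 : ContMDiff I' I.tangent 0 (fun y ↦ (⟨c y, V y⟩ : TangentBundle I M)) := contMDiff_zero_iff.mpr hV
  have hW0 : ContMDiff I' I.tangent 0 (fun y ↦ (⟨c y, W y⟩ : TangentBundle I M)) := contMDiff_zero_iff.mpr hW
  have h : ContMDiff I' (I.prod 𝓘(ℝ, ℝ)) 0
      (fun y ↦ TotalSpace.mk' ℝ (E := Bundle.Trivial M ℝ) (c y) (g.val (c y) (V y) (W y))) :=
    (hg0.comp hc0).clm_bundle_apply₂ (F₁ := E) (F₂ := E) hV0 hW0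
  rw [← contMDiff_zero_iff (I := I') (I' := 𝓘(ℝ, ℝ))]
  intro y
  have hy := h y
  simp only [contMDiffAt_totalSpace] at hy
  exact hy.2

end Generic

/-! ### The orientation character of an exact chart -/

open ChartData (lab_mem_pullK_iff contMDiffAt_chart val_mfderiv_chart eq_zero_of_mfderiv_chart_eq_zero)

variable [Kerr.Facts] {𝒮 : Spacetime.{0} 4} {mo : lorentzGroup × E4} {M a : ℝ} {B : ModelBackground}
  {Ψ : B.domain → 𝒮.carrier} {lab : Kerr.region a M → B.domain} {Q : Set (Kerr.region a M)}

/-- **The orientation character `q ↦ g_𝒮(T, dΦ V)` of an exact chart is continuous on `Q`** (as a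
function on the open sub-manifold `Q`). [cite: ONeill1983, Ch. 5, p. 145] -/
theorem continuous_orientSign (hlab : ∀ z, (lab z : E4) = (mo.1 : E4 ≃L[ℝ] E4) z.1 + mo.2)
    (hQ : IsOpen Q) (hB : B = starBackground mo.1 mo.2 M a (fun x => Kerr.radius a (poincareInv mo.1 mo.2 x)))
    (hs : ContMDiffOn 𝓘(ℝ, E4) (𝓡 4) ∞ Ψ (pullK mo M a B Q)) :
    Continuous fun q : (⟨Q, hQ⟩ : Opens (Kerr.region a M)) =>
      𝒮.metric.val (Ψ (lab q.1)) (𝒮.timeOrientation.vectorField (Ψ (lab q.1)))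
        (mfderiv 𝓘(ℝ, E4) (𝓡 4) (Ψ ∘ lab) q.1 (Kerr.timeVector M a q.1.1)) := by
  set Q' : Opens (Kerr.region a M) := ⟨Q, hQ⟩
  set ΦQ : Q' → 𝒮.carrier := fun q => Ψ (lab q.1) with hΦQ_def
  have hΦs : ContMDiff 𝓘(ℝ, E4) (𝓡 4) ∞ ΦQ := fun q =>
    (contMDiffAt_chart hlab hQ hB hs q.2).1.comp q (contMDiff_subtype_val q)
  have hdΦ : ∀ q : Q', mfderiv 𝓘(ℝ, E4) (𝓡 4) ΦQ q = mfderiv 𝓘(ℝ, E4) (𝓡 4) (Ψ ∘ lab) q.1 := fun q =>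
    mfderiv_comp_subtypeVal ((contMDiffAt_chart hlab hQ hB hs q.2).1.mdifferentiableAt (by simp))
  -- the Kerr-star orientation as a continuous section of `TQ`
  have hsec : Continuous fun q : Q' => (⟨q, Kerr.timeVector M a q.1.1⟩ : TangentBundle 𝓘(ℝ, E4) Q') := by
    refine continuous_iff_continuousAt.2 fun q => ?_
    have h1 : MDifferentiableAt 𝓘(ℝ, E4) 𝓘(ℝ, E4).tangent
        (fun q : Q' => (TotalSpace.mk' E4 (q.1 : Kerr.region a M) (Kerr.timeVector M a q.1.1) :
          TangentBundle 𝓘(ℝ, E4) (Kerr.region a M))) q := by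
      have hV := (Kerr.Facts.contMDiff_timeVector M a M).mdifferentiable (by simp)
      exact (hV q.1).comp q ((contMDiff_subtype_val (n := ∞) q).mdifferentiableAt (by simp))
    exact ((mdifferentiableAt_totalSpace_opens_iff Q' (b := fun q : Q' => q)).2 h1).continuousAt
  -- `q ↦ (Φ q, dΦ V)` is `tangentMap ΦQ` of that section
  have hW : Continuous fun q : Q' => (⟨ΦQ q, mfderiv 𝓘(ℝ, E4) (𝓡 4) ΦQ q (Kerr.timeVector M a q.1.1)⟩ :
      TangentBundle (𝓡 4) 𝒮.carrier) :=
    (hΦs.continuous_tangentMap (by simp)).comp hsec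
  have hT : Continuous fun q : Q' => (⟨ΦQ q, 𝒮.timeOrientation.vectorField (ΦQ q)⟩ :
      TangentBundle (𝓡 4) 𝒮.carrier) :=
    𝒮.timeOrientation.contMDiff.continuous.comp hΦs.continuous
  have key := continuous_val_of_continuous 𝓘(ℝ, E4) 𝒮.metric hΦs.continuous hT hW
  refine key.congr fun q => ?_
  show 𝒮.metric.val (ΦQ q) (𝒮.timeOrientation.vectorField (ΦQ q))
    (mfderiv 𝓘(ℝ, E4) (𝓡 4) ΦQ q (Kerr.timeVector M a q.1.1)) = _
  rw [hdΦ q]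
  rfl

omit [Kerr.Facts] in
/-- **The orientation character never vanishes** (`T` and `dΦ V` are timelike). [cite: ONeill1983, Ch. 5, Lemma 5.26] -/
theorem orientSign_ne_zero (hM : 0 < M) (hlab : ∀ z, (lab z : E4) = (mo.1 : E4 ≃L[ℝ] E4) z.1 + mo.2)
    (hQ : IsOpen Q) (hB : B = starBackground mo.1 mo.2 M a (fun x => Kerr.radius a (poincareInv mo.1 mo.2 x)))
    (hs : ContMDiffOn 𝓘(ℝ, E4) (𝓡 4) ∞ Ψ (pullK mo M a B Q))
    (hd : supCkENorm (Subtype.val '' pullK mo M a B Q) 0 (𝒮.deviationExtend B Ψ) ≤ 0)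
    {z : Kerr.region a M} (hz : z ∈ Q) :
    𝒮.metric.val ((Ψ ∘ lab) z) (𝒮.timeOrientation.vectorField ((Ψ ∘ lab) z))
      (mfderiv 𝓘(ℝ, E4) (𝓡 4) (Ψ ∘ lab) z (Kerr.timeVector M a z.1)) ≠ 0 := by
  have hiso := val_mfderiv_chart hlab hQ hB hs hd hz
  have hzr : 0 < Kerr.radius a z.1 := Kerr.radius_pos_of_mem_region z.2
  have hVt : 𝒮.metric.IsTimelike (mfderiv 𝓘(ℝ, E4) (𝓡 4) (Ψ ∘ lab) z (Kerr.timeVector M a z.1)) := by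
    show 𝒮.metric.val _ _ _ < 0
    rw [hiso]; exact Kerr.bilin_timeVector_timeVector_neg hM.le a hzr
  exact 𝒮.metric.val_ne_zero_of_isTimelike_of_isCausal (𝒮.timeOrientation.isTimelike _) hVt.isCausal

/-- **Constancy of the orientation character on connected sets**: if the chart pushes `V` to a
future-directed vector at one point `z₁` of a preconnected subset `A ⊆ Q`, it does so at every point of
`A`. [cite: ONeill1983, Ch. 5, p. 145] -/
theorem isFutureDirected_of_isPreconnected (hM : 0 < M)
    (hlab : ∀ z, (lab z : E4) = (mo.1 : E4 ≃L[ℝ] E4) z.1 + mo.2)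
    (hQ : IsOpen Q) (hB : B = starBackground mo.1 mo.2 M a (fun x => Kerr.radius a (poincareInv mo.1 mo.2 x)))
    (hs : ContMDiffOn 𝓘(ℝ, E4) (𝓡 4) ∞ Ψ (pullK mo M a B Q))
    (hd : supCkENorm (Subtype.val '' pullK mo M a B Q) 0 (𝒮.deviationExtend B Ψ) ≤ 0)
    {A : Set (Kerr.region a M)} (hA : IsPreconnected A) (hAQ : A ⊆ Q)
    {z₁ : Kerr.region a M} (hz₁ : z₁ ∈ A)
    (h₁ : 𝒮.timeOrientation.IsFutureDirected (mfderiv 𝓘(ℝ, E4) (𝓡 4) (Ψ ∘ lab) z₁ (Kerr.timeVector M a z₁.1)))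
    {z : Kerr.region a M} (hz : z ∈ A) :
    𝒮.timeOrientation.IsFutureDirected (mfderiv 𝓘(ℝ, E4) (𝓡 4) (Ψ ∘ lab) z (Kerr.timeVector M a z.1)) := by
  set Q' : Opens (Kerr.region a M) := ⟨Q, hQ⟩
  set f : Q' → ℝ := fun q => 𝒮.metric.val (Ψ (lab q.1)) (𝒮.timeOrientation.vectorField (Ψ (lab q.1)))
    (mfderiv 𝓘(ℝ, E4) (𝓡 4) (Ψ ∘ lab) q.1 (Kerr.timeVector M a q.1.1)) with hf
  have hfc : Continuous f := continuous_orientSign hlab hQ hB hs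
  -- `A` as a preconnected subset of `Q'`
  set A' : Set Q' := Subtype.val ⁻¹' A with hA'
  have hA'c : IsPreconnected A' := by
    have himg : Subtype.val '' A' = A := by
      ext y; constructor
      · rintro ⟨q, hq, rfl⟩; exact hq
      · intro hy; exact ⟨⟨y, hAQ hy⟩, hy, rfl⟩
    have h := hA
    rw [← himg] at h
    exact (IsInducing.subtypeVal.isPreconnected_image (s := A')).1 h
  -- timelikeness of `dΦ V`
  have htl : ∀ {w : Kerr.region a M}, w ∈ Q →
      𝒮.metric.IsTimelike (mfderiv 𝓘(ℝ, E4) (𝓡 4) (Ψ ∘ lab) w (Kerr.timeVector M a w.1)) := fun {w} hw => by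
    show 𝒮.metric.val _ _ _ < 0
    rw [val_mfderiv_chart hlab hQ hB hs hd hw]
    exact Kerr.bilin_timeVector_timeVector_neg hM.le a (Kerr.radius_pos_of_mem_region w.2)
  -- sign at `z₁` is negative; if nonnegative at `z`, an intermediate zero contradicts `orientSign_ne_zero`
  have hneg₁ : f ⟨z₁, hAQ hz₁⟩ < 0 := h₁.2
  have hneg : f ⟨z, hAQ hz⟩ < 0 := by
    by_contra hge
    push Not at hge
    obtain ⟨q, -, hq0⟩ := hA'c.intermediate_value₂ (show (⟨z₁, hAQ hz₁⟩ : Q') ∈ A' from hz₁)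
      (show (⟨z, hAQ hz⟩ : Q') ∈ A' from hz) hfc.continuousOn continuousOn_const hneg₁.le hge
    exact orientSign_ne_zero hM hlab hQ hB hs hd q.2 hq0
  exact ⟨(htl (hAQ hz)).isCausal, hneg⟩

end OrientK

/-- **Registered bookkeeping sub-goal `stub_exactChartOrientSignNeZero` of the line** (brick of the
landing of K2b-5 `stub_marchingLemma`): the orientation character `g_𝒮(T, dΦ V)` of an exact chart never
vanishes (anchor of this file, whose content is its continuity `OrientK.continuous_orientSign` and the
constancy of its sign on connected sets `OrientK.isFutureDirected_of_isPreconnected`).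
[cite: ONeill1983, Ch. 5, Lemma 5.26] -/
theorem stub_exactChartOrientSignNeZero : ∀ (𝒮 : Spacetime.{0} 4) (mo : lorentzGroup × E4) (M a : ℝ) (hM : 0 < M)
    (B : ModelBackground) (Ψ : B.domain → 𝒮.carrier) (lab : Kerr.region a M → B.domain) (Q : Set (Kerr.region a M)),
    (∀ z, (lab z : E4) = (mo.1 : E4 ≃L[ℝ] E4) z.1 + mo.2) → IsOpen Q →
    B = starBackground mo.1 mo.2 M a (fun x => Kerr.radius a (poincareInv mo.1 mo.2 x)) →
    ContMDiffOn 𝓘(ℝ, E4) (𝓡 4) ∞ Ψ (pullK mo M a B Q) →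
    supCkENorm (Subtype.val '' pullK mo M a B Q) 0 (𝒮.deviationExtend B Ψ) ≤ 0 →
    ∀ z ∈ Q, 𝒮.metric.val ((Ψ ∘ lab) z) (𝒮.timeOrientation.vectorField ((Ψ ∘ lab) z))
      (mfderiv 𝓘(ℝ, E4) (𝓡 4) (Ψ ∘ lab) z (Kerr.timeVector M a z.1)) ≠ 0 :=
  fun _ _ _ _ hM _ _ _ _ hlab hQ hB hs hd _ hz => OrientK.orientSign_ne_zero hM hlab hQ hB hs hd hz

end Summit.FinalStateConjecture.FinalStateConjecture.Theorems.BondiBartnikRigidity.DirectMethod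

end
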